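import Summits.QuantumFields.BalabanUV.T4Continuum.Spine.NE2.ComposedRemainderCoherentTowerDeltaPrime
import Summits.QuantumFields.BalabanUV.T4Continuum.Spine.NE2.TorusBlockAverageConstant

/-!
# T⁴ programme, spine node NE2 (U1a) — CONSTANT-CONNECTION TOWERS `u_k^{(i)} ≡ exp(f(k,i)·X)` AND THE END's DATA LETTERS AT THEM (cell `pub-balaban-gaps`, seat ne2 gen 8)

The END of record of this node for [B9] (3.26) at model level, `ComposedRemainderCoherentTowerSizes.composed_full_averaging_deltaPrime_rate_of_coherentTowers_top`, displays
its hypotheses on DATA: coherent towers `u k i` of unitary lattice gauge fields with finest-level letters (size `α_U/L^k`, lattice-Lipschitz `β_U/L^{2k}`, plaquette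
`p_U/L^{2k}`), the chain closeness `σ_U θ_c^k/L^i`, node NE3's `LocalRate` on the top adjoint field, the six `Δ′` field letters and `Y_x ∈ P`; its only non-vacuity witness so
far is the FLAT tower, at which every operator of the tower is the free one.  THIS FILE builds a witness that is NOT flat at the operator level and proves its DATA letters;
the END is instantiated on them in `ComposedRemainderCoherentTowerConstant`.  For a skew-hermitian colour matrix `X` and phases `f(k,i)` the tower is `u_k^{(i)}(y, κ) := exp(f(k,i)·X)`;
two phase families are carried: the CONSTANT-CONNECTION tower `f = cph`, `c_{k,i} = L^{−(k+i)}` (`i ≤ k`; the connection `A = L^{−k}X` of problem `k` at spacing `L^{−i}`) and the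
STATIONARY tower `f = sph`, `L^{−i}` (`i ≤ k`; the SAME continuum connection `X` in every problem) — zero curvature, non-trivial holonomy along the torus cycles, and for
non-central `X` a NON-TRIVIAL adjoint transport `Ad(exp(f·X))` (hence non-trivial tier-B perturbation, composed averaging tables and (124)-remainders); junk levels `i > k` flat.
 * §1 the phases `cph L k i = L^{−(k+i)}` (`L·c_{k,i+1} = c_{k,i}`, `0 ≤ c_{k,i} − c_{k+1,i} ≤ L^{−k}L^{−i}`) and the STATIONARY phases `sph L k i = L^{−i}` (`sph L (k+1) i = sph L k i`:
   the same continuum connection `X` in every problem; the size letter `α_U/L^k` is saturated);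
 * §2 one-parameter unitary data: `exp(r·X) ∈ U(n)`, `‖exp(r·X) − 1‖ ≤ r·t`, `‖exp(r·X) − exp(s·X)‖ ≤ (s − r)·t` (`0 ≤ r ≤ 1`, resp. `r ≤ s ≤ r + 1`), `t := ‖X‖e^{‖X‖}`; `exp(r·X)^L = exp(L·r·X)`;
   `exp Y ≠ 1` for `0 < ‖Y‖ ≤ ½`;
 * §3 constant-per-level towers `cTow f X` (`u_k^{(i)} ≡ exp(f(k,i)X)`): unitary, flat where `f = 0`, **COHERENT** whenever `L·f(k,i+1) = f(k,i)` — Bałaban's average (42) of the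
   constant configuration `exp(f(k,i+1)X)` is `exp(f(k,i+1)X)^L` (`TorusBlockAverageConstant.bavgTor_const` + `Matrix.exp_nsmul`) —, not flat where `0 < f ≤ 1` (`cTow_ne_one`); both
   `cph` and `sph` qualify (`cTow_cph_coherent`, `cTow_sph_coherent`);
 * §4 the END's DATA binders at a constant-per-level tower: the loop logarithms `Y_x = 0` (`loopHol_const`: the thin loop of (114) is closed, every transport a power of the
   constant), the `Δ′` fields `S = B = 0` (`plaqHol_const`), the finest size `‖u_k^{(k)} − 1‖ ≤ t/L^k` whenever `f(k,k) ≤ L^{−k}` (`t := ‖X‖e^{‖X‖}`), the chain closeness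
   `‖u_{k+1}^{(i)} − u_k^{(i)}‖ ≤ D·t` from `0 ≤ f(k,i) − f(k+1,i) ≤ D`, and node NE3's `LocalRate` on `regClass (Ad u_top)` for the constant-connection tower with `C = 4t`
   (`localRate_cTow_cph`, by `NE2FromNE3.localRate_of_consistent`: the derivative tower vanishes and each connection reading is separately `≤ 2t/L^k` because that top field is
   doubly small, `O(L^{−2k})`; the stationary tower's NE3 letter is a genuine second-order cancellation, proved in `ComposedRemainderCoherentTowerConstant`).
HONEST FRAMING (T4-DAG p. 1).  Letters of a TOY datum (constant connection) for a model-level END; NOT Bałaban's minimiser; nothing of Bałaban's asserted beyond print; NOT NE2;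
**NE2 (U1a) NOT PROVED**; spine PROVED 0/9 unchanged; NOT continuum YM / infinite volume / mass gap / Clay.  No `sorry`.
-/

noncomputable section

open scoped BigOperators ComplexConjugate Matrix Matrix.Norms.L2Operator

namespace Summit.QuantumFields.BalabanUV.T4Continuum.NE2.ConstantConnectionTower

open Literature.MathematicalPhysics.QuantumFieldTheory.Balaban1983to89
open Literature.MathematicalPhysics.QuantumFieldTheory.Balaban1983to89.B7Prop1Explicit (expUnit val_expUnit norm_exp_sub_one_le_of_norm_le expRem_le_sq)
open Literature.MathematicalPhysics.QuantumFieldTheory.Balaban1983to89.B5Prop11Plancherel (Tor fine)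
open Literature.MathematicalPhysics.QuantumFieldTheory.Balaban1983to89.B5G183RateUnitTower (lev)
open Literature.MathematicalPhysics.QuantumFieldTheory.Balaban1983to89.B5G183RateTorus (cpt)
open Literature.MathematicalPhysics.QuantumFieldTheory.Balaban1983to89.T4EtaRateMin (LocalRate)
open Literature.MathematicalPhysics.QuantumFieldTheory.Balaban1983to89.MatrixLog (mlog_one)
open Literature.MathematicalPhysics.QuantumFieldTheory.Balaban1983to89.B9Eq373V3 (exp_sub_one_le_mul_exp_of_le)
open Summit.QuantumFields.BalabanUV.Beta.AdjointCarrierWiringEnd (CompFamily)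
open Summit.QuantumFields.BalabanUV.T4Continuum
open Summit.QuantumFields.BalabanUV.T4Continuum.BalabanAveragedTowerUnit (idx cast_lev')
open Summit.QuantumFields.BalabanUV.T4Continuum.AbelianCovariantLaplacian (tauInv)
open Summit.QuantumFields.BalabanUV.T4Continuum.RegularBackgroundTower (regClass connTower dconnTower connTower_eq)
open Summit.QuantumFields.BalabanUV.T4Continuum.NE2FromNE3 (bgReadings localRate_of_consistent)
open Summit.QuantumFields.BalabanUV.T4Continuum.CovariantBlockAveraging (transport length_leg)
open Summit.QuantumFields.BalabanUV.T4Continuum.CovariantLineSlotExp (norm_le_one_of_mem_unitary)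
open Summit.QuantumFields.BalabanUV.T4Continuum.NE2.CovariantTableBalaban (length_contourFrom)
open Summit.QuantumFields.BalabanUV.T4Continuum.NE2.OneStepLoopHolonomy (loopHol Yx)
open Summit.QuantumFields.BalabanUV.T4Continuum.NE2.OneStepRemainderLoopCoeff (YxT)
open Summit.QuantumFields.BalabanUV.T4Continuum.NE2.ComposedRemainderGaugeTower (fundT)
open Summit.QuantumFields.BalabanUV.T4Continuum.NE2.ComposedRemainderGaugeTowerRegular (topAdT)
open Summit.QuantumFields.BalabanUV.T4Continuum.NE2.AdjointFieldInstance (norm_adRep_sub_one_le dist1_unitaryGroup)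
open Summit.QuantumFields.BalabanUV.T4Continuum.NE2.TorusBlockAveragePlaquette (bavgTor)
open Summit.QuantumFields.BalabanUV.T4Continuum.NE2.TorusBlockAverageConstant (bavgTor_const)
open Summit.QuantumFields.BalabanUV.T4Continuum.NE2.ComposedRemainderCoherentTower (liftU)
open Summit.QuantumFields.BalabanUV.T4Continuum.NE2.DeltaPrimeOperator (plaqHol reHol imHol symF_zero brkF_zero)
open Summit.QuantumFields.BalabanUV.T4Continuum.NE2.DeltaPrimeCatalogue (Bfield)
open Summit.QuantumFields.BalabanUV.T4Continuum.NE2.DeltaPrimeSecondOrder (Sfield)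
open Summit.QuantumFields.BalabanUV.T4Continuum.NE2.ComposedRemainderCoherentTowerDeltaPrime (topU)

variable {d : ℕ}

/-! ## §1 The phases `c_{k,i} = L^{−(k+i)}` (junk `0` above the top) -/

section Phase

variable (L : ℕ)

/-- the phase of level `i` of problem `k`: `L^{−(k+i)}` for `i ≤ k`, `0` (flat junk) above the top. [folklore] -/
def cph (k i : ℕ) : ℝ := if i ≤ k then (((L : ℝ) ^ (k + i)))⁻¹ else 0

/-- below the top the phase is `L^{−(k+i)}`. [folklore] -/
theorem cph_of_le {k i : ℕ} (h : i ≤ k) : cph L k i = (((L : ℝ) ^ (k + i)))⁻¹ := by rw [cph, if_pos h]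

/-- above the top the phase is `0`. [folklore] -/
theorem cph_of_lt {k i : ℕ} (h : k < i) : cph L k i = 0 := by rw [cph, if_neg (not_le.mpr h)]

/-- the phases are nonnegative. [folklore] -/
theorem cph_nonneg (k i : ℕ) : 0 ≤ cph L k i := by
  unfold cph; split_ifs <;> positivity

/-- the phases are at most `1` (`L ≥ 1`). [folklore] -/
theorem cph_le_one (hL : 1 ≤ L) (k i : ℕ) : cph L k i ≤ 1 := by
  unfold cph
  split_ifs
  · exact inv_le_one_of_one_le₀ (one_le_pow₀ (by exact_mod_cast hL))
  · exact zero_le_one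

/-- **coherence of the phases**: `L·c_{k,i+1} = c_{k,i}` for `i < k`. [folklore] -/
theorem mul_cph_succ (hL : 1 ≤ L) {k i : ℕ} (h : i < k) : (L : ℝ) * cph L k (i + 1) = cph L k i := by
  have hL0 : (L : ℝ) ≠ 0 := (Nat.cast_pos.mpr (Nat.lt_of_lt_of_le Nat.zero_lt_one hL)).ne'
  rw [cph_of_le L (Nat.succ_le_of_lt h), cph_of_le L h.le, show k + (i + 1) = (k + i) + 1 by ring, pow_succ, mul_inv, mul_left_comm,
    mul_inv_cancel₀ hL0, mul_one]

/-- the top phase is `L^{−2k} ≤ L^{−k}·1`, precisely `c_{k,k} ≤ (L^k)⁻¹` (`L ≥ 1`). [folklore] -/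
theorem cph_top_le (hL : 1 ≤ L) (k : ℕ) : cph L k k ≤ ((L : ℝ) ^ k)⁻¹ := by
  rw [cph_of_le L le_rfl, pow_add, mul_inv]
  have h1 : ((L : ℝ) ^ k)⁻¹ ≤ 1 := inv_le_one_of_one_le₀ (one_le_pow₀ (by exact_mod_cast hL))
  have h0 : 0 ≤ ((L : ℝ) ^ k)⁻¹ := by positivity
  nlinarith

/-- **closeness of the phases of consecutive problems**: `0 ≤ c_{k,i} − c_{k+1,i} ≤ L^{−k}·L^{−i}` for `i ≤ k` (`L ≥ 1`). [folklore] -/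
theorem cph_sub_cph_succ (hL : 1 ≤ L) {k i : ℕ} (h : i ≤ k) :
    0 ≤ cph L k i - cph L (k + 1) i ∧ cph L k i - cph L (k + 1) i ≤ ((L : ℝ)⁻¹) ^ k * ((L : ℝ) ^ i)⁻¹ := by
  have hL1 : (1 : ℝ) ≤ L := by exact_mod_cast hL
  rw [cph_of_le L h, cph_of_le L (h.trans (Nat.le_succ k)), show k + 1 + i = (k + i) + 1 by ring, pow_succ, mul_inv, pow_add, mul_inv, inv_pow]
  have h0 : 0 ≤ ((L : ℝ) ^ k)⁻¹ * ((L : ℝ) ^ i)⁻¹ := by positivity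
  have hLi : (L : ℝ)⁻¹ ≤ 1 := inv_le_one_of_one_le₀ hL1
  have hLi0 : 0 ≤ (L : ℝ)⁻¹ := by positivity
  constructor <;> nlinarith


/-- the STATIONARY phases: `L^{−i}` for `i ≤ k`, `0` above the top — the SAME continuum connection `X` in every problem, sampled at spacing `L^{−i}`. [folklore] -/
def sph (k i : ℕ) : ℝ := if i ≤ k then (((L : ℝ) ^ i))⁻¹ else 0

/-- below the top the stationary phase is `L^{−i}`. [folklore] -/
theorem sph_of_le {k i : ℕ} (h : i ≤ k) : sph L k i = (((L : ℝ) ^ i))⁻¹ := by rw [sph, if_pos h]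

/-- above the top it is `0`. [folklore] -/
theorem sph_of_lt {k i : ℕ} (h : k < i) : sph L k i = 0 := by rw [sph, if_neg (not_le.mpr h)]

/-- the stationary phases are nonnegative. [folklore] -/
theorem sph_nonneg (k i : ℕ) : 0 ≤ sph L k i := by
  unfold sph; split_ifs <;> positivity

/-- **coherence of the stationary phases**: `L·L^{−(i+1)} = L^{−i}` (`i < k`). [folklore] -/
theorem mul_sph_succ (hL : 1 ≤ L) {k i : ℕ} (h : i < k) : (L : ℝ) * sph L k (i + 1) = sph L k i := by
  have hL0 : (L : ℝ) ≠ 0 := (Nat.cast_pos.mpr (Nat.lt_of_lt_of_le Nat.zero_lt_one hL)).ne'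
  rw [sph_of_le L (Nat.succ_le_of_lt h), sph_of_le L h.le, pow_succ, mul_inv, mul_left_comm, mul_inv_cancel₀ hL0, mul_one]

/-- **stationarity**: problems `k` and `k+1` carry the SAME field at every common level `i ≤ k`. [folklore] -/
theorem sph_succ_eq {k i : ℕ} (h : i ≤ k) : sph L (k + 1) i = sph L k i := by
  rw [sph_of_le L h, sph_of_le L (h.trans (Nat.le_succ k))]

/-- the top stationary phase is exactly `(L^k)⁻¹` — the size letter `α_U/L^k` is SATURATED. [folklore] -/
theorem sph_top (k : ℕ) : sph L k k = ((L : ℝ) ^ k)⁻¹ := sph_of_le L le_rfl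

end Phase

/-! ## §2 One-parameter unitary data `exp(r·X)`, `X` skew-hermitian -/

section OneParameter

variable {n : Type} [Fintype n] [DecidableEq n]

/-- **`exp(r·X) ∈ U(n)`** for skew-hermitian `X` and real `r`. [folklore] -/
theorem exp_smul_mem_unitaryGroup {X : Matrix n n ℂ} (hX : star X = -X) (r : ℝ) : NormedSpace.exp (((r : ℝ) : ℂ) • X) ∈ Matrix.unitaryGroup n ℂ := by
  set Y : Matrix n n ℂ := ((r : ℝ) : ℂ) • X
  have hY : star Y = -Y := by rw [star_smul, hX, smul_neg, Complex.star_def, Complex.conj_ofReal]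
  have hYH : Yᴴ = -Y := by rwa [← Matrix.star_eq_conjTranspose]
  have hexpH : (NormedSpace.exp Y)ᴴ = NormedSpace.exp (-Y) := by rw [← Matrix.exp_conjTranspose, hYH]
  refine Unitary.mem_iff.mpr ⟨?_, ?_⟩
  · rw [Matrix.star_eq_conjTranspose, hexpH, ← Matrix.exp_add_of_commute _ _ (Commute.refl Y).neg_left, neg_add_cancel, NormedSpace.exp_zero]
  · rw [Matrix.star_eq_conjTranspose, hexpH, ← Matrix.exp_add_of_commute _ _ (Commute.refl Y).neg_right, add_neg_cancel, NormedSpace.exp_zero]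

/-- **SIZE**: `‖exp(r·X) − 1‖ ≤ r·‖X‖e^{‖X‖}` for `0 ≤ r ≤ 1`. [folklore] -/
theorem norm_exp_smul_sub_one_le {r : ℝ} (hr0 : 0 ≤ r) (hr1 : r ≤ 1) (X : Matrix n n ℂ) :
    ‖NormedSpace.exp (((r : ℝ) : ℂ) • X) - 1‖ ≤ r * (‖X‖ * Real.exp ‖X‖) := by
  have hB : ‖(((r : ℝ) : ℂ) • X)‖ ≤ r * ‖X‖ := by rw [norm_smul, Complex.norm_real, Real.norm_eq_abs, abs_of_nonneg hr0]
  refine (norm_exp_sub_one_le_of_norm_le hB).1.trans ?_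
  rw [← mul_assoc]
  exact exp_sub_one_le_mul_exp_of_le (mul_nonneg hr0 (norm_nonneg X)) (mul_le_of_le_one_left (norm_nonneg X) hr1)

/-- **CLOSENESS**: `‖exp(r·X) − exp(s·X)‖ ≤ (s − r)·‖X‖e^{‖X‖}` for `r ≤ s ≤ r + 1`, `X` skew-hermitian (`exp(r·X) − exp(s·X) = exp(r·X)(1 − exp((s−r)·X))`,
`‖exp(r·X)‖ ≤ 1`). [folklore] -/
theorem norm_exp_smul_sub_exp_smul_le {X : Matrix n n ℂ} (hX : star X = -X) {r s : ℝ} (hrs : r ≤ s) (hsr : s ≤ r + 1) :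
    ‖NormedSpace.exp (((r : ℝ) : ℂ) • X) - NormedSpace.exp (((s : ℝ) : ℂ) • X)‖ ≤ (s - r) * (‖X‖ * Real.exp ‖X‖) := by
  have hsplit : (((s : ℝ) : ℂ) • X) = (((r : ℝ) : ℂ) • X) + ((((s - r : ℝ)) : ℂ) • X) := by
    rw [← add_smul, ← Complex.ofReal_add, add_sub_cancel]
  have hcomm : Commute ((((r : ℝ) : ℂ) • X)) (((((s - r : ℝ)) : ℂ) • X)) := ((Commute.refl X).smul_left _).smul_right _
  rw [hsplit, Matrix.exp_add_of_commute _ _ hcomm, ← mul_one_sub]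
  calc ‖NormedSpace.exp (((r : ℝ) : ℂ) • X) * (1 - NormedSpace.exp ((((s - r : ℝ)) : ℂ) • X))‖
      ≤ ‖NormedSpace.exp (((r : ℝ) : ℂ) • X)‖ * ‖1 - NormedSpace.exp ((((s - r : ℝ)) : ℂ) • X)‖ := norm_mul_le _ _
    _ ≤ 1 * ((s - r) * (‖X‖ * Real.exp ‖X‖)) := by
        refine mul_le_mul (norm_le_one_of_mem_unitary (exp_smul_mem_unitaryGroup hX r)) ?_ (norm_nonneg _) zero_le_one
        rw [norm_sub_rev]
        exact norm_exp_smul_sub_one_le (sub_nonneg.mpr hrs) (by linarith) X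
    _ = (s - r) * (‖X‖ * Real.exp ‖X‖) := one_mul _

omit [Fintype n] [DecidableEq n] in
/-- `(r·X)` and `(L·r)·X`: `L • (r·X) = (L·r)·X`. [folklore] -/
theorem nsmul_real_smul (L : ℕ) (r : ℝ) (X : Matrix n n ℂ) : L • (((r : ℝ) : ℂ) • X) = (((L : ℝ) * r : ℝ) : ℂ) • X := by
  rw [← Nat.cast_smul_eq_nsmul ℂ, smul_smul, Complex.ofReal_mul, Complex.ofReal_natCast]

/-- **COHERENCE OF ONE-PARAMETER DATA UNDER POWERS**: `exp(r·X)^L = exp((L·r)·X)`. [folklore] -/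
theorem exp_smul_pow (L : ℕ) (r : ℝ) (X : Matrix n n ℂ) : NormedSpace.exp (((r : ℝ) : ℂ) • X) ^ L = NormedSpace.exp ((((L : ℝ) * r : ℝ) : ℂ) • X) := by
  rw [← nsmul_real_smul, Matrix.exp_nsmul]

/-- **NON-TRIVIALITY**: `exp Y ≠ 1` for `0 < ‖Y‖ ≤ ½` (`‖exp Y − 1 − Y‖ ≤ e^{‖Y‖} − 1 − ‖Y‖ ≤ ‖Y‖² < ‖Y‖`). [folklore] -/
theorem exp_ne_one_of_small {Y : Matrix n n ℂ} (h0 : 0 < ‖Y‖) (h1 : ‖Y‖ ≤ 1 / 2) : NormedSpace.exp Y ≠ 1 := by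
  intro h
  have h2 := (norm_exp_sub_one_le_of_norm_le (le_refl ‖Y‖)).2
  rw [h, sub_self, zero_sub, norm_neg] at h2
  have h3 := expRem_le_sq h0.le (by linarith)
  nlinarith

end OneParameter

/-! ## §3 Constant-per-level towers `exp(f(k,i)·X)`; the constant-connection and the stationary towers -/

section Tower

variable (L : ℕ) [NeZero L] (M : Fin d → ℕ) [hM : ∀ μ, NeZero (M μ)] {n : Type} [Fintype n] [DecidableEq n]

/-- **A CONSTANT-PER-LEVEL TOWER**: `u_k^{(i)}(y, κ) := exp(f(k,i)·X)` on `Tor (fine (lev L i) M)` — the same unitary on every bond of level `i` of problem `k`; the constant-connection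
tower is `f = cph L` (`L^{−(k+i)}`), the stationary tower is `f = sph L` (`L^{−i}`). [folklore] -/
def cTow (f : ℕ → ℕ → ℝ) (X : Matrix n n ℂ) : ℕ → (i : ℕ) → Tor (fine (lev L i) M) → Fin d → (Matrix n n ℂ)ˣ :=
  fun k i _ _ => expUnit (((f k i : ℝ) : ℂ) • X)

omit [NeZero L] hM in
/-- the bond variables of the tower as matrices. [folklore] -/
theorem cTow_val (f : ℕ → ℕ → ℝ) (X : Matrix n n ℂ) (k i : ℕ) (y : Tor (fine (lev L i) M)) (κ : Fin d) :
    ((cTow L M f X k i y κ : (Matrix n n ℂ)ˣ) : Matrix n n ℂ) = NormedSpace.exp (((f k i : ℝ) : ℂ) • X) := rfl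

omit [NeZero L] hM in
/-- **UNITARITY** (`X` skew-hermitian). [folklore] -/
theorem cTow_mem (f : ℕ → ℕ → ℝ) {X : Matrix n n ℂ} (hX : star X = -X) (k i : ℕ) (y : Tor (fine (lev L i) M)) (κ : Fin d) :
    ((cTow L M f X k i y κ : (Matrix n n ℂ)ˣ) : Matrix n n ℂ) ∈ Matrix.unitaryGroup n ℂ :=
  exp_smul_mem_unitaryGroup hX _

omit [NeZero L] hM in
/-- a level with phase `0` is FLAT. [folklore] -/
theorem cTow_eq_one {f : ℕ → ℕ → ℝ} (X : Matrix n n ℂ) {k i : ℕ} (h : f k i = 0) : cTow L M f X k i = fun _ _ => 1 := by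
  funext y κ
  refine Units.ext ?_
  rw [cTow_val, h, Complex.ofReal_zero, zero_smul, NormedSpace.exp_zero, Units.val_one]

omit [NeZero L] hM in
/-- **COHERENCE**: if `L·f(k,i+1) = f(k,i)` then level `i` is Bałaban's average (42) of level `i+1` — the average of the constant configuration `exp(f(k,i+1)X)` is the constant
configuration `exp(f(k,i+1)X)^L = exp(L·f(k,i+1)·X)`. [cite: Balaban1985Averaging, (15) p.19, (42) p.23 (shape)] [folklore] -/
theorem cTow_coherent {f : ℕ → ℕ → ℝ} (X : Matrix n n ℂ) {k i : ℕ} (h : (L : ℝ) * f k (i + 1) = f k i) : cTow L M f X k i = bavgTor (lev L i) L M (cTow L M f X k (i + 1)) := by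
  show cTow L M f X k i = bavgTor (lev L i) L M (fun (_ : Tor (fine (L * lev L i) M)) (_ : Fin d) => expUnit (((f k (i + 1) : ℝ) : ℂ) • X))
  rw [bavgTor_const]
  funext y κ
  refine Units.ext ?_
  rw [cTow_val, Units.val_pow_eq_pow_val, val_expUnit, exp_smul_pow, h]

omit [NeZero L] hM in
/-- **NON-FLATNESS**: a level with phase `0 < f(k,i) ≤ 1` is not `1` when `0 < ‖X‖ ≤ ½`. [folklore] -/
theorem cTow_ne_one {f : ℕ → ℕ → ℝ} {X : Matrix n n ℂ} (h0 : 0 < ‖X‖) (h1 : ‖X‖ ≤ 1 / 2) {k i : ℕ} (hf0 : 0 < f k i) (hf1 : f k i ≤ 1) (y : Tor (fine (lev L i) M)) (κ : Fin d) :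
    ((cTow L M f X k i y κ : (Matrix n n ℂ)ˣ) : Matrix n n ℂ) ≠ 1 := by
  rw [cTow_val]
  refine exp_ne_one_of_small ?_ ?_
  · rw [norm_smul, Complex.norm_real, Real.norm_eq_abs, abs_of_nonneg hf0.le]; exact mul_pos hf0 h0
  · rw [norm_smul, Complex.norm_real, Real.norm_eq_abs, abs_of_nonneg hf0.le]; nlinarith [norm_nonneg X]

omit hM in
/-- the CONSTANT-CONNECTION tower `exp(L^{−(k+i)}X)` is coherent below the top and flat above it. [folklore] -/
theorem cTow_cph_coherent (X : Matrix n n ℂ) : (∀ k i, i < k → cTow L M (cph L) X k i = bavgTor (lev L i) L M (cTow L M (cph L) X k (i + 1))) ∧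
    (∀ k i, k < i → cTow L M (cph L) X k i = fun _ _ => 1) :=
  ⟨fun _ _ h => cTow_coherent L M X (mul_cph_succ L (Nat.one_le_iff_ne_zero.mpr (NeZero.ne L)) h), fun _ _ h => cTow_eq_one L M X (cph_of_lt L h)⟩

omit hM in
/-- the STATIONARY tower `exp(L^{−i}X)` is coherent below the top and flat above it. [folklore] -/
theorem cTow_sph_coherent (X : Matrix n n ℂ) : (∀ k i, i < k → cTow L M (sph L) X k i = bavgTor (lev L i) L M (cTow L M (sph L) X k (i + 1))) ∧
    (∀ k i, k < i → cTow L M (sph L) X k i = fun _ _ => 1) :=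
  ⟨fun _ _ h => cTow_coherent L M X (mul_sph_succ L (Nat.one_le_iff_ne_zero.mpr (NeZero.ne L)) h), fun _ _ h => cTow_eq_one L M X (sph_of_lt L h)⟩

end Tower

/-! ## §4 The END's data binders at a constant-per-level tower -/

section Letters

variable (L : ℕ) [NeZero L] (M : Fin d → ℕ) [hM : ∀ μ, NeZero (M μ)] {n : Type} [Fintype n] [DecidableEq n]
  {ι : Type} [Fintype ι] [DecidableEq ι] {c : ℝ} {P : Submodule ℝ (Matrix n n ℂ)} {e : ι → Matrix n n ℂ} (hF : CompFamily c P e)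

/-- **TRANSPORTS OF CONSTANT DATA ARE POWERS** (the END's 1-form-carrier transport `transport`). [folklore] -/
theorem transport_const {Q : Fin d → ℕ} [∀ μ, NeZero (Q μ)] (w : Matrix n n ℂ) (μ : Fin d) (Γ : List (Tor Q × Fin d)) :
    transport Q (fun (_ : Fin d) (_ : Tor Q × Fin d) => w) μ Γ = w ^ Γ.length := by
  rw [transport, List.map_const', List.prod_replicate]

/-- **THE THIN LOOP OF (114) IS CLOSED**: at constant unitary data `w` its holonomy is `w^{Σr+ℓ}·(w^{ℓ}·w^{Σr})ᴴ = 1`. [cite: Balaban1985Averaging, (114) p.34 (shape)] [folklore] -/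
theorem loopHol_const (N : ℕ) [NeZero N] {w : Matrix n n ℂ} (hw : w ∈ Matrix.unitaryGroup n ℂ) (μ : Fin d) (ℓ : ℕ) (z : Tor (fine N M)) (r : Fin d → ℕ) :
    loopHol N M (fun (_ : Fin d) (_ : Tor (fine N M) × Fin d) => w) μ ℓ z r = 1 := by
  rw [loopHol, transport_const, transport_const, transport_const, length_contourFrom, length_contourFrom, length_leg, add_zero, ← pow_add, add_comm ℓ,
    ← Matrix.star_eq_conjTranspose]
  exact Matrix.mem_unitaryGroup_iff.mp (Submonoid.pow_mem _ hw _)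

/-- **THE LOOP LOGARITHMS VANISH**: `Y_x = 0` at every step of a constant-per-level tower (so `Y_x ∈ P` for any carrier `P`). [cite: Balaban1985Averaging, (114) p.34 (shape)] [folklore] -/
theorem YxT_cTow (f : ℕ → ℕ → ℝ) {X : Matrix n n ℂ} (hX : star X = -X) (k i : ℕ) (x : Tor (fine (lev L i) M)) (μ : Fin d) (r : Fin d → Fin L) :
    YxT L M (fundT L M (liftU L M (cTow L M f X) (cTow_mem L M f hX) k)) i x μ r = 0 := by
  show Yx (L * lev L i) M (fun (_ : Fin d) (_ : Tor (fine (L * lev L i) M) × Fin d) => NormedSpace.exp (((f k (i + 1) : ℝ) : ℂ) • X)) μ L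
      (cpt (lev L i) L M x) (fun ν => (r ν : ℕ)) = 0
  rw [Yx, loopHol_const M (L * lev L i) (exp_smul_mem_unitaryGroup hX _), mlog_one, smul_zero]

/-- **THE PLAQUETTE HOLONOMY OF CONSTANT UNITARY DATA IS TRIVIAL** (the `Δ′` files' `plaqHol`, matrix inverses). [folklore] -/
theorem plaqHol_const {Q : Fin d → ℕ} [∀ μ, NeZero (Q μ)] {w : Matrix n n ℂ} (hw : w ∈ Matrix.unitaryGroup n ℂ) (x : Tor Q) (μ ν : Fin d) :
    plaqHol Q (fun (_ : Fin d) (_ : Tor Q) => w) x μ ν = 1 := by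
  have hdet : IsUnit w.det := (Matrix.isUnit_iff_isUnit_det w).mp ⟨⟨w, star w, Unitary.mul_star_self_of_mem hw, Unitary.star_mul_self_of_mem hw⟩, rfl⟩
  show w * w * w⁻¹ * w⁻¹ = 1
  rw [Matrix.mul_nonsing_inv_cancel_right w w hdet, Matrix.mul_nonsing_inv w hdet]

/-- hence `Re U(∂p) = 1` … [folklore] -/
theorem reHol_const {Q : Fin d → ℕ} [∀ μ, NeZero (Q μ)] {w : Matrix n n ℂ} (hw : w ∈ Matrix.unitaryGroup n ℂ) (x : Tor Q) (μ ν : Fin d) :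
    reHol Q (fun (_ : Fin d) (_ : Tor Q) => w) x μ ν = 1 := by
  rw [reHol, plaqHol_const hw, inv_one, ← two_smul ℂ (1 : Matrix n n ℂ), smul_smul]
  norm_num

/-- … and `Im U(∂p) = 0`. [folklore] -/
theorem imHol_const {Q : Fin d → ℕ} [∀ μ, NeZero (Q μ)] {w : Matrix n n ℂ} (hw : w ∈ Matrix.unitaryGroup n ℂ) (x : Tor Q) (μ ν : Fin d) :
    imHol Q (fun (_ : Fin d) (_ : Tor Q) => w) x μ ν = 0 := by
  rw [imHol, plaqHol_const hw, inv_one, sub_self, smul_zero]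

omit [Fintype ι] [DecidableEq ι] in
/-- **THE `Δ′` FIELDS OF A CONSTANT-PER-LEVEL TOWER VANISH**: `S = 0` … [cite: Balaban1985BackgroundPropagators, (3.10) p.392 (shape)] [folklore] -/
theorem Sfield_cTow (f : ℕ → ℕ → ℝ) {X : Matrix n n ℂ} (hX : star X = -X) (cη : ℝ) (k : ℕ) (μ ν : Fin d) (x : Tor (fine (lev L k) M)) :
    Sfield (fine (lev L k) M) cη c e (fun ν x => ((topU L M (cTow L M f X) (cTow_mem L M f hX) k ν x : Matrix.unitaryGroup n ℂ) : Matrix n n ℂ)) μ ν x = 0 := by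
  show Sfield (fine (lev L k) M) cη c e (fun (_ : Fin d) (_ : Tor (fine (lev L k) M)) => NormedSpace.exp (((f k k : ℝ) : ℂ) • X)) μ ν x = 0
  rw [Sfield, reHol_const (exp_smul_mem_unitaryGroup hX _), sub_self, smul_zero, symF_zero]

omit [Fintype ι] [DecidableEq ι] in
/-- … and `B = 0`. [cite: Balaban1985BackgroundPropagators, (3.10) p.392 (shape)] [folklore] -/
theorem Bfield_cTow (f : ℕ → ℕ → ℝ) {X : Matrix n n ℂ} (hX : star X = -X) (cη : ℝ) (k : ℕ) (μ ν : Fin d) (x : Tor (fine (lev L k) M)) :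
    Bfield (fine (lev L k) M) cη c e (fun ν x => ((topU L M (cTow L M f X) (cTow_mem L M f hX) k ν x : Matrix.unitaryGroup n ℂ) : Matrix n n ℂ)) μ ν x = 0 := by
  show Bfield (fine (lev L k) M) cη c e (fun (_ : Fin d) (_ : Tor (fine (lev L k) M)) => NormedSpace.exp (((f k k : ℝ) : ℂ) • X)) μ ν x = 0
  rw [Bfield, imHol_const (exp_smul_mem_unitaryGroup hX _), smul_zero, brkF_zero]

omit hM in
/-- **THE FINEST-LEVEL SIZE LETTER**: if `0 ≤ f(k,k) ≤ (L^k)⁻¹` then `‖u_k^{(k)} − 1‖ ≤ t/L^k`, `t = ‖X‖e^{‖X‖}` (saturated by the stationary tower; the constant-connection tower is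
`O(L^{−2k})`). [folklore] -/
theorem norm_cTow_top_sub_one_le {f : ℕ → ℕ → ℝ} (X : Matrix n n ℂ) (k : ℕ) (hf0 : 0 ≤ f k k) (hf1 : f k k ≤ ((L : ℝ) ^ k)⁻¹) (y : Tor (fine (lev L k) M)) (κ : Fin d) :
    ‖((cTow L M f X k k y κ : (Matrix n n ℂ)ˣ) : Matrix n n ℂ) - 1‖ ≤ (‖X‖ * Real.exp ‖X‖) / (lev L k : ℕ) := by
  have hL : (1 : ℝ) ≤ L := by exact_mod_cast Nat.one_le_iff_ne_zero.mpr (NeZero.ne L)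
  have hf1' : f k k ≤ 1 := hf1.trans (inv_le_one_of_one_le₀ (one_le_pow₀ hL))
  rw [cTow_val, cast_lev', div_eq_mul_inv, mul_comm]
  refine (norm_exp_smul_sub_one_le hf0 hf1' X).trans ?_
  exact mul_le_mul_of_nonneg_right hf1 (by positivity)

omit [NeZero L] hM in
/-- **THE CHAIN CLOSENESS** (NE3's statement shape on the data): if `0 ≤ f(k,i) − f(k+1,i) ≤ D` (phases in `[0,1]`) then `‖u_{k+1}^{(i)} − u_k^{(i)}‖ ≤ D·t`. [folklore] -/
theorem norm_liftU_succ_sub_le {f : ℕ → ℕ → ℝ} (hf0 : ∀ k i, 0 ≤ f k i) (hf1 : ∀ k i, f k i ≤ 1) {X : Matrix n n ℂ} (hX : star X = -X) {k i : ℕ} {D : ℝ}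
    (hD : 0 ≤ f k i - f (k + 1) i ∧ f k i - f (k + 1) i ≤ D) (ν : Fin d) (b : idx L M i) :
    ‖(liftU L M (cTow L M f X) (cTow_mem L M f hX) (k + 1) i ν b : Matrix n n ℂ) - (liftU L M (cTow L M f X) (cTow_mem L M f hX) k i ν b : Matrix n n ℂ)‖
      ≤ D * (‖X‖ * Real.exp ‖X‖) := by
  show ‖NormedSpace.exp (((f (k + 1) i : ℝ) : ℂ) • X) - NormedSpace.exp (((f k i : ℝ) : ℂ) • X)‖ ≤ _
  have hle1 : f k i ≤ f (k + 1) i + 1 := by have := hf1 k i; have := hf0 (k + 1) i; linarith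
  refine (norm_exp_smul_sub_exp_smul_le hX (sub_nonneg.mp hD.1) hle1).trans ?_
  exact mul_le_mul_of_nonneg_right hD.2 (by positivity)

/-- **NODE NE3's `LocalRate` AT THE CONSTANT-CONNECTION TOWER**, constant `C = 4t`: on `regClass (Ad u_top)` = {connection, its lattice derivative} the consecutive
readings differ by `≤ 4t·L^{−k}` — the derivative tower vanishes (constant data) and each connection reading `L^k(Ad(exp(L^{−2k}X)) − 1)` is SEPARATELY `≤ 2t·L^{−k}`
(`‖Ad g − 1‖ ≤ 2‖g − 1‖`, `AdjointFieldInstance.norm_adRep_sub_one_le`) because the top field is doubly small.  (The stationary tower needs a second-order cancellation instead: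
`ComposedRemainderCoherentTowerConstant.localRate_cTow_sph`.) [folklore] -/
theorem localRate_cTow_cph [Nonempty n] [Nonempty ι] {X : Matrix n n ℂ} (hX : star X = -X) :
    LocalRate (bgReadings L M (regClass L M (topAdT L M hF (liftU L M (cTow L M (cph L) X) (cTow_mem L M (cph L) hX))))) (4 * (‖X‖ * Real.exp ‖X‖)) ((L : ℝ)⁻¹) := by
  have hL : 1 ≤ L := Nat.one_le_iff_ne_zero.mpr (NeZero.ne L)
  have hL1 : (1 : ℝ) ≤ L := by exact_mod_cast hL
  set t : ℝ := ‖X‖ * Real.exp ‖X‖ with ht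
  have ht0 : 0 ≤ t := by positivity
  set R := topAdT L M hF (liftU L M (cTow L M (cph L) X) (cTow_mem L M (cph L) hX)) with hR
  -- each connection reading is ≤ 2t/L^k
  have hconn : ∀ k ν (i : idx L M k), ‖connTower L M R k ν i‖ ≤ 2 * t * ((L : ℝ) ^ k)⁻¹ := fun k ν i => by
    rw [connTower_eq, norm_smul, Complex.norm_natCast, cast_lev']
    have hg : ‖R k ν i - 1‖ ≤ 2 * (cph L k k * t) := by
      refine (norm_adRep_sub_one_le hF _).trans ?_
      rw [dist1_unitaryGroup]
      exact mul_le_mul_of_nonneg_left (norm_exp_smul_sub_one_le (cph_nonneg L k k) (cph_le_one L hL k k) X) zero_le_two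
    have hc : (L : ℝ) ^ k * cph L k k ≤ ((L : ℝ) ^ k)⁻¹ := by
      rw [cph_of_le L le_rfl, pow_add, mul_inv, ← mul_assoc, mul_inv_cancel₀ (by positivity), one_mul]
    calc (L : ℝ) ^ k * ‖R k ν i - 1‖ ≤ (L : ℝ) ^ k * (2 * (cph L k k * t)) := mul_le_mul_of_nonneg_left hg (by positivity)
      _ = 2 * t * ((L : ℝ) ^ k * cph L k k) := by ring
      _ ≤ 2 * t * ((L : ℝ) ^ k)⁻¹ := mul_le_mul_of_nonneg_left hc (by positivity)
  -- the connection tower is constant along each level, so its lattice derivative vanishes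
  have hconst : ∀ k ν (i j : idx L M k), connTower L M R k ν i = connTower L M R k ν j := fun k ν i j => rfl
  have hdconn : ∀ k ν (i : idx L M k), dconnTower L M R k ν i = 0 := fun k ν i => by
    rw [dconnTower, hconst k ν i (tauInv (fine (lev L k) M) ν i), sub_self, smul_zero]
  refine localRate_of_consistent L M fun W hW k ν x' => ?_
  have hpow : ((L : ℝ) ^ (k + 1))⁻¹ ≤ ((L : ℝ) ^ k)⁻¹ := by
    rw [pow_succ, mul_inv]
    exact mul_le_of_le_one_right (by positivity) (inv_le_one_of_one_le₀ hL1)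
  have hmono : 2 * t * ((L : ℝ) ^ (k + 1))⁻¹ ≤ 2 * t * ((L : ℝ) ^ k)⁻¹ := mul_le_mul_of_nonneg_left hpow (by positivity)
  rcases hW with rfl | rfl
  · refine (norm_sub_le _ _).trans ((add_le_add (hconn _ _ _) (hconn _ _ _)).trans ?_)
    rw [cast_lev', div_eq_mul_inv]
    linarith
  · rw [hdconn, hdconn, sub_self, norm_zero]; positivity

end Letters

end Summit.QuantumFields.BalabanUV.T4Continuum.NE2.ConstantConnectionTower

end
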